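import Mathlib
import Summits.NavierStokesRegularity.NavierStokesRegularity.Theorems.ThreadingFluxCentreJetDefs
import Summits.NavierStokesRegularity.NavierStokesRegularity.Theorems.ThreadingFluxCentreJetFirstLemmas
import Summits.NavierStokesRegularity.NavierStokesRegularity.Theorems.ThreadingFluxCentreJetStrainLaw
import Summits.NavierStokesRegularity.NavierStokesRegularity.Theorems.ThreadingFluxCentreJetVorticityJet
import HarnessLib

/-!
# Crux `PoloidalLiouville` (stmt-NavierStokesRegularity-1222, wall W1), crux idea «steady-centre-sieve» (ns-idea-15 g5):
# the four S-statements of `ThreadingFluxCentreJetDefs.lean` BY NAME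

Support file (Theorems-side glue; seat ns-wall-eng-7 g4, cell ns-wall-extremal, W1 adjunct; `--supports
stmt-NavierStokesRegularity-1222 --as helper`).  One-line η-wrappers of the verbatim-body kernel theorems over the Theorems-side Defs
twin: `centreVorticityJet_holds : CentreVorticityJet` (E1), `centreStrainLawAlgebra_holds : CentreStrainLawAlgebra` (E3),
`irrotationalSteadyLiouville_holds : IrrotationalSteadyLiouville` (R3), `zonalSatisfiesStrainLaw_holds : ZonalSatisfiesStrainLaw`
(sanity) — `IsUnthreadedAbout` / `IsSteadyNSOn` unfold by `rfl`.

HONEST LABEL: information-grade S-lemmas of an idea card; the card's conjectures and target, `PoloidalLiouville` (1222) and NS regularity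
remain OPEN and untouched.  [cite: MajdaBertozziCUP2002, §1.1 (vector identities)]
-/

-- the summit and its single problem share the name (D-0017 nested layout)
set_option linter.dupNamespace false

noncomputable section

namespace Summit.NavierStokesRegularity.NavierStokesRegularity.Theorems.PoloidalLiouville.CentreJet

/-- ★ **(E1) `CentreVorticityJet` BY NAME.** -/
theorem centreVorticityJet_holds : CentreVorticityJet :=
  fun V x₀ hV hun => centreVorticityJet V x₀ hV hun

/-- ★ **(E3) `CentreStrainLawAlgebra` BY NAME.** -/
theorem centreStrainLawAlgebra_holds : CentreStrainLawAlgebra :=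
  fun c M hc hsymm hQ => centreStrainLawAlgebra c M hc hsymm hQ

/-- ★ **(R3) `IrrotationalSteadyLiouville` BY NAME.** -/
theorem irrotationalSteadyLiouville_holds : IrrotationalSteadyLiouville :=
  fun V p hNS hB hcurl => irrotationalSteadyLiouville V p hNS hB hcurl

/-- **(sanity) `ZonalSatisfiesStrainLaw` BY NAME.** -/
theorem zonalSatisfiesStrainLaw_holds : ZonalSatisfiesStrainLaw :=
  fun c y l μ => zonalSatisfiesStrainLaw c y l μ

end Summit.NavierStokesRegularity.NavierStokesRegularity.Theorems.PoloidalLiouville.CentreJet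

end
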